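import Summits.AtomisticToContinuum.BoseEinsteinCondensation.Theorems.InfraredMinimumUncertainty.Negative.FreeDensityWaveBragg

/-!
# Negative lemmas for crux `InfraredMinimumUncertainty` (stmt-AtomisticToContinuum-11784) — IV:
# the minimiser hypothesis is load-bearing

Supports (does not close) stmt-AtomisticToContinuum-11784 (route `BECConjugateDomination`, crux
`InfraredMinimumUncertainty`, IMU: `Π_m := N·ν_m·S_m ≤ C` for positive torus minimisers, all
`m ≠ 0`, uniformly in `N` and `ρ < ρ₀`).  Importable form of §A and §C of
`Cruxes/InfraredMinimumUncertainty/Disproof.lean` (generation 1).  Nothing here asserts a Theses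
decl positively: the two refuted statements are STRENGTHENINGS of the crux
(`not_nearMinimisers_of_not_imu`, `nearMinimisers_of_withoutMinimality`).

* §A `Body`, `imu_iff` (the crux unbundled over `InSmoothClass` / `IsPositiveMinimiser` /
  `levyWeight` / `structureFactor`), `Body.mono_C`, `Body.mono_ρ₀`, `inSmoothClass_zero` (the
  free gas is in the smooth class: nothing is vacuous).
* §C `free_near_minimiser_witness` — for `v ≡ 0`, every `ρ > 0`, every `n` and every slack
  `δ > 0` a positive real admissible `Ψ` with `periodicEnergy 0 Ψ ≤ δ` and
  `Π_{e₀}(Ψ) ≥ min(N²/128, (δL²)²/(128π⁴))` (the density wave of amplitude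
  `ε² = min(1/16, δL²/(16π²N))`); `eventually_lt_pi_free_near_minimiser` (`Π → ∞` at every FIXED
  slack); `eventually_lt_pi_free_vanishing_slack` (`Π → ∞` even with slack `1/L → 0`); `not_infraredMinimumUncertaintyNearMinimisers` — the crux with `E = E₀` weakened to
  `E ≤ E₀ + δ` (`δ > 0` chosen after `ρ`, before `N`) is FALSE; `imu_false_without_minimality` —
  the crux with `E = E₀` deleted is FALSE.  Moral for provers: the minimiser property must be used
  below the resolution of the first torus gap `(2π/L)² ≍ (ρ/N)^{2/3}`; no `N`-uniform energy
  slack (the precision of every printed energy asymptotics) survives.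
-/

noncomputable section

open MeasureTheory Filter Set
open scoped ENNReal NNReal Topology ComplexConjugate BigOperators

namespace Summit.AtomisticToContinuum.BoseEinsteinCondensation.Theorems.InfraredMinimumUncertainty.Negative

open Literature.MathematicalPhysics.QuantumManyBody.BoseGas
open Summit.AtomisticToContinuum.BoseEinsteinCondensation.Theses.BECConjugateDomination
open Summit.AtomisticToContinuum.BoseEinsteinCondensation.Cruxes.InfraredMinimumUncertainty.FisherGaussianDensityMode
open Summit.AtomisticToContinuum.BoseEinsteinCondensation.Theorems.StaticResponseBound.Negative
  (arg arg_intSMul re_cellWave integral_cell_cos_arg integral_cell_const phiMode continuous_arg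
    contDiff_arg continuous_phiMode contDiff_phiMode arg_add_single phiMode_periodic phiMode_pos
    integral_cell_trig_combo integral_cell_phiMode_sq integral_cell_cos_mul_phiMode_sq
    isFiniteMeasure_restrict_cell argCLM argCLM_apply argCLM_single hasFDerivAt_phiMode
    isRepulsiveFiniteRange_zero integral_norm_sq_eq_one)
open Summit.AtomisticToContinuum.BoseEinsteinCondensation.Theorems.CorrectorClosure.Negative
  (e0 e0_ne_zero sideLength_succ_pos)

/-! ## §A  The crux unbundled over the landed vocabulary -/

/-- The crux's body at fixed `(v, C, ρ₀)`: for `0 < ρ < ρ₀`, eventually in `N = n+1`, every positive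
minimiser `Ψ` on the torus of side `(N/ρ)^{1/3}` has `N·ν_m·S_m ≤ C` for all `m ≠ 0`. [folklore] -/
def Body (v : ℝ → ℝ≥0∞) (C ρ₀ : ℝ) : Prop :=
  ∀ ρ : ℝ, 0 < ρ → ρ < ρ₀ → ∀ᶠ n : ℕ in atTop,
    ∀ Ψ : PeriodicTrialState (n + 1) (sideLength ρ (n + 1)), IsPositiveMinimiser v Ψ →
      ∀ m : Fin 3 → ℤ, m ≠ 0 →
        ((n : ℝ) + 1) * levyWeight n (sideLength ρ (n + 1)) Ψ m *
          structureFactor n (sideLength ρ (n + 1)) Ψ m ≤ C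

/-- The crux is `∀ v ∈ smooth class, ∃ C ≥ 0, ∃ ρ₀ > 0, Body v C ρ₀` (the `let`s of the crux are
the landed `coherence`/`levyWeight`/`structureFactor` verbatim). [folklore] -/
theorem imu_iff :
    InfraredMinimumUncertainty ↔
      ∀ v : ℝ → ℝ≥0∞, InSmoothClass v → ∃ C : ℝ, 0 ≤ C ∧ ∃ ρ₀ : ℝ, 0 < ρ₀ ∧ Body v C ρ₀ := by
  constructor
  · intro h v hv
    obtain ⟨C, hC, ρ₀, hρ₀, hB⟩ := h v hv.1 hv.2.1 hv.2.2.1 hv.2.2.2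
    refine ⟨C, hC, ρ₀, hρ₀, fun ρ hρ hρρ₀ => ?_⟩
    filter_upwards [hB ρ hρ hρρ₀] with n hn Ψ hΨ m hm
    exact hn Ψ hΨ.1 hΨ.2.1 hΨ.2.2.1 hΨ.2.2.2 m hm
  · intro h v h₁ h₂ h₃ h₄
    obtain ⟨C, hC, ρ₀, hρ₀, hB⟩ := h v ⟨h₁, h₂, h₃, h₄⟩
    refine ⟨C, hC, ρ₀, hρ₀, fun ρ hρ hρρ₀ => ?_⟩
    filter_upwards [hB ρ hρ hρρ₀] with n hn Ψ
    intro L g ν S hE hfin hreal hpos m hm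
    exact hn Ψ ⟨hE, hfin, hreal, hpos⟩ m hm

/-- A larger constant only weakens the body. [folklore] -/
theorem Body.mono_C {v : ℝ → ℝ≥0∞} {C C' ρ₀ : ℝ} (h : Body v C ρ₀) (hCC' : C ≤ C') :
    Body v C' ρ₀ := fun ρ hρ hρρ₀ =>
  (h ρ hρ hρρ₀).mono fun _ hn Ψ hΨ m hm => (hn Ψ hΨ m hm).trans hCC'

/-- A smaller density threshold only weakens the body. [folklore] -/
theorem Body.mono_ρ₀ {v : ℝ → ℝ≥0∞} {C ρ₀ ρ₀' : ℝ} (h : Body v C ρ₀) (hle : ρ₀' ≤ ρ₀) :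
    Body v C ρ₀' := fun ρ hρ hρρ₀ => h ρ hρ (hρρ₀.trans_le hle)

/-- **The free gas is in the smooth class** (`v ≡ 0`: measurable, range `0`, finite, `ṽ ≡ 0` is
`C²` with `D²ṽ = 0 ≤ Cₑ√0`).  So none of the statements below is vacuous, and every `_false_without_`
theorem of this file is witnessed INSIDE the class. [folklore] -/
theorem inSmoothClass_zero : InSmoothClass (0 : ℝ → ℝ≥0∞) := by
  refine ⟨isRepulsiveFiniteRange_zero, fun _ => by simp, ?_, ⟨0, fun x => ?_⟩⟩
  · have : (fun x : Space => ((0 : ℝ → ℝ≥0∞) ‖x‖).toReal) = fun _ => 0 := by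
      funext x; simp
    rw [this]
    exact contDiff_const
  · have : (fun x : Space => ((0 : ℝ → ℝ≥0∞) ‖x‖).toReal) = fun _ : Space => (0 : ℝ) := by
      funext x; simp
    rw [this, iteratedFDeriv_fun_zero]
    simp

/-! ## §C  Minimality is load-bearing: near-minimisers of the FREE gas with `Π → ∞` -/

section LoadBearing

/-- `Π` over the landed vocabulary IS the crux's `let`-bound product (definitional). [folklore] -/
theorem piProd_eq (n : ℕ) (L : ℝ) (Ψ : PeriodicTrialState (n + 1) L) (m : Fin 3 → ℤ) :
    piProd n L Ψ m = ((n : ℝ) + 1) * levyWeight n L Ψ m * structureFactor n L Ψ m := rfl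

/-- **THE WITNESS.** Free gas, any `ρ > 0`, any `N = n+1`, any slack `δ > 0`: the density wave of
amplitude `ε² = min(1/16, δL²/(16π²N))` is a positive real admissible state with
`periodicEnergy 0 Ψ ≤ δ` and `Π_{e₀}(Ψ) ≥ min(N²/128, (δL²)²/(128π⁴))`, `L = (N/ρ)^{1/3}`. [folklore] -/
theorem free_near_minimiser_witness {ρ : ℝ} (hρ : 0 < ρ) (n : ℕ) {δ : ℝ} (hδ : 0 < δ) :
    ∃ Ψ : PeriodicTrialState (n + 1) (sideLength ρ (n + 1)),
      periodicEnergy 0 Ψ ≤ ENNReal.ofReal δ ∧ (∀ X, Ψ.ψ X = (‖Ψ.ψ X‖ : ℂ)) ∧ (∀ X, Ψ.ψ X ≠ 0) ∧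
        min ((((n : ℝ) + 1) ^ 2) / 128) ((δ * sideLength ρ (n + 1) ^ 2) ^ 2 / (128 * Real.pi ^ 4)) ≤
          piProd n (sideLength ρ (n + 1)) Ψ e0 := by
  set L := sideLength ρ (n + 1) with hLdef
  have hL : 0 < L := sideLength_succ_pos hρ n
  have hN : (0 : ℝ) < (n : ℝ) + 1 := by positivity
  set s : ℝ := min (1 / 16) (δ * L ^ 2 / (16 * Real.pi ^ 2 * ((n : ℝ) + 1))) with hs
  have hs0 : 0 < s := lt_min (by norm_num) (by positivity)
  have hs16 : s ≤ 1 / 16 := min_le_left _ _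
  set ε : ℝ := Real.sqrt s with hεdef
  have hε2 : ε ^ 2 = s := Real.sq_sqrt hs0.le
  have hεpos : 0 < ε := Real.sqrt_pos.mpr hs0
  have hε : |ε| < 1 / 2 := by
    rw [abs_of_pos hεpos]
    have : ε ≤ Real.sqrt (1 / 16) := Real.sqrt_le_sqrt hs16
    rw [show (1 / 16 : ℝ) = (1 / 4) ^ 2 by norm_num, Real.sqrt_sq (by norm_num)] at this
    linarith
  refine ⟨waveState n hL ε, ?_, waveFun_eq_norm hL hε, waveFun_ne_zero hL hε, ?_⟩
  · refine (periodicEnergy_waveState_le hL).trans (ENNReal.ofReal_le_ofReal ?_)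
    rw [hε2, div_le_iff₀ (by positivity : (0 : ℝ) < L ^ 2)]
    have h2 : s ≤ δ * L ^ 2 / (16 * Real.pi ^ 2 * ((n : ℝ) + 1)) := min_le_right _ _
    rw [le_div_iff₀ (by positivity)] at h2
    linarith
  · refine le_trans ?_ (pi_waveState_ge hL hε (by rw [hε2]; exact hs16))
    rw [show ε ^ 4 = s ^ 2 by rw [← hε2]; ring]
    rcases min_cases (1 / 16 : ℝ) (δ * L ^ 2 / (16 * Real.pi ^ 2 * ((n : ℝ) + 1))) with ⟨h, _⟩ | ⟨h, _⟩
    · rw [← hs] at h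
      rw [h]
      refine (min_le_left _ _).trans (le_of_eq ?_)
      ring
    · rw [← hs] at h
      rw [h]
      refine (min_le_right _ _).trans (le_of_eq ?_)
      field_simp
      ring

/-- `L³ = N/ρ`. [folklore] -/
theorem sideLength_succ_pow_three {ρ : ℝ} (hρ : 0 < ρ) (n : ℕ) :
    sideLength ρ (n + 1) ^ 3 = ((n : ℝ) + 1) / ρ := by
  have h := div_sideLength_pow_three hρ (Nat.succ_pos n)
  have hL : 0 < sideLength ρ (n + 1) := sideLength_succ_pos hρ n
  have hL3 : 0 < sideLength ρ (n + 1) ^ 3 := by positivity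
  rw [div_eq_iff hL3.ne'] at h
  rw [eq_div_iff hρ.ne', mul_comm]
  push_cast at h
  linarith

/-- **`Π → ∞` along free near-minimisers at FIXED slack**: for `v ≡ 0`, every `ρ > 0`, `δ > 0`
and `C`, eventually in `N` there is a positive real admissible `Ψ` with
`periodicEnergy 0 Ψ ≤ E₀ + δ` and `Π_{e₀}(Ψ) > C`. [folklore] -/
theorem eventually_lt_pi_free_near_minimiser {ρ : ℝ} (hρ : 0 < ρ) {δ : ℝ} (hδ : 0 < δ) (C : ℝ) :
    ∀ᶠ n : ℕ in atTop, ∃ Ψ : PeriodicTrialState (n + 1) (sideLength ρ (n + 1)),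
      periodicEnergy 0 Ψ ≤ ENNReal.ofReal δ ∧
      periodicEnergy 0 Ψ ≤ periodicGroundStateEnergy 0 (n + 1) (sideLength ρ (n + 1)) +
          ENNReal.ofReal δ ∧
        (∀ X, Ψ.ψ X = (‖Ψ.ψ X‖ : ℂ)) ∧ (∀ X, Ψ.ψ X ≠ 0) ∧
          C < piProd n (sideLength ρ (n + 1)) Ψ e0 := by
  set κ : ℝ := min (1 / 128) (δ ^ 2 / (128 * Real.pi ^ 4 * ρ)) with hκ
  have hκ0 : 0 < κ := lt_min (by norm_num) (by positivity)
  have h1 : ∀ᶠ n : ℕ in atTop, ρ ≤ (n : ℝ) := tendsto_natCast_atTop_atTop.eventually_ge_atTop ρ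
  have h2 : ∀ᶠ n : ℕ in atTop, C / κ < (n : ℝ) := tendsto_natCast_atTop_atTop.eventually_gt_atTop _
  filter_upwards [h1, h2] with n hn1 hn2
  obtain ⟨Ψ, hE, hreal, hpos, hPi⟩ := free_near_minimiser_witness hρ n hδ
  refine ⟨Ψ, hE, hE.trans le_add_self, hreal, hpos, lt_of_lt_of_le ?_ hPi⟩
  have hN : (0 : ℝ) < (n : ℝ) + 1 := by positivity
  have hL3 := sideLength_succ_pow_three hρ n
  set L := sideLength ρ (n + 1) with hLdef
  have hL : 0 < L := sideLength_succ_pos hρ n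
  -- `L ≥ 1` since `L³ = N/ρ ≥ 1`
  have hL1 : 1 ≤ L := by
    by_contra h
    rw [not_le] at h
    have : L ^ 3 < 1 := by
      calc L ^ 3 < 1 ^ 3 := pow_lt_pow_left₀ h hL.le three_ne_zero
        _ = 1 := one_pow 3
    rw [hL3, div_lt_one hρ] at this
    linarith
  have hL4 : ((n : ℝ) + 1) / ρ ≤ L ^ 4 := by
    rw [← hL3]
    calc L ^ 3 = L ^ 3 * 1 := (mul_one _).symm
      _ ≤ L ^ 3 * L := mul_le_mul_of_nonneg_left hL1 (by positivity)
      _ = L ^ 4 := by ring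
  -- `κ (n+1) ≤ min(...)` and `C < κ (n + 1)`
  have hCκ : C < κ * ((n : ℝ) + 1) := by
    rw [div_lt_iff₀ hκ0] at hn2
    nlinarith
  refine hCκ.trans_le (le_min ?_ ?_)
  · calc κ * ((n : ℝ) + 1) ≤ (1 / 128) * ((n : ℝ) + 1) :=
          mul_le_mul_of_nonneg_right (min_le_left _ _) hN.le
      _ ≤ ((n : ℝ) + 1) ^ 2 / 128 := by nlinarith
  · calc κ * ((n : ℝ) + 1) ≤ δ ^ 2 / (128 * Real.pi ^ 4 * ρ) * ((n : ℝ) + 1) :=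
          mul_le_mul_of_nonneg_right (min_le_right _ _) hN.le
      _ = δ ^ 2 / (128 * Real.pi ^ 4) * (((n : ℝ) + 1) / ρ) := by field_simp
      _ ≤ δ ^ 2 / (128 * Real.pi ^ 4) * L ^ 4 := mul_le_mul_of_nonneg_left hL4 (by positivity)
      _ = (δ * L ^ 2) ^ 2 / (128 * Real.pi ^ 4) := by ring

/-- **Even a VANISHING slack does not help unless it resolves the first gap**: for `v ≡ 0`, every
`ρ > 0` and every `C`, eventually in `N` there is a positive real admissible `Ψ` with
`periodicEnergy 0 Ψ ≤ 1/L` (`L = (N/ρ)^{1/3} → ∞`, so the slack tends to `0`) and `Π_{e₀}(Ψ) > C`.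
In general the witness of `free_near_minimiser_witness` has `Π ≳ (δ_N L²)²`, unbounded as soon
as `δ_N L_N² → ∞`, i.e. for every slack that is not `O`(first torus gap `(2π/L)²`). [folklore] -/
theorem eventually_lt_pi_free_vanishing_slack {ρ : ℝ} (hρ : 0 < ρ) (C : ℝ) :
    ∀ᶠ n : ℕ in atTop, ∃ Ψ : PeriodicTrialState (n + 1) (sideLength ρ (n + 1)),
      periodicEnergy 0 Ψ ≤ ENNReal.ofReal (sideLength ρ (n + 1))⁻¹ ∧
        (∀ X, Ψ.ψ X = (‖Ψ.ψ X‖ : ℂ)) ∧ (∀ X, Ψ.ψ X ≠ 0) ∧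
          C < piProd n (sideLength ρ (n + 1)) Ψ e0 := by
  set K : ℝ := 128 * Real.pi ^ 4 * (max C 0 + 1) with hK
  have hC0 : 0 ≤ max C 0 := le_max_right _ _
  have hK0 : 0 < K := by positivity
  set M : ℝ := max K 1 with hM
  have hM1 : 1 ≤ M := le_max_right _ _
  have h1 : ∀ᶠ n : ℕ in atTop, ρ * M ^ 3 < (n : ℝ) :=
    tendsto_natCast_atTop_atTop.eventually_gt_atTop _
  have h2 : ∀ᶠ n : ℕ in atTop, (128 * (max C 0 + 1) : ℝ) < (n : ℝ) :=
    tendsto_natCast_atTop_atTop.eventually_gt_atTop _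
  filter_upwards [h1, h2] with n hn1 hn2
  have hL : 0 < sideLength ρ (n + 1) := sideLength_succ_pos hρ n
  obtain ⟨Ψ, hE, hreal, hpos, hPi⟩ := free_near_minimiser_witness hρ n (inv_pos.mpr hL)
  refine ⟨Ψ, hE, hreal, hpos, lt_of_lt_of_le ?_ hPi⟩
  have hL3 := sideLength_succ_pow_three hρ n
  set L := sideLength ρ (n + 1) with hLdef
  have hL0 : L ≠ 0 := hL.ne'
  have hLM : M < L := by
    refine lt_of_pow_lt_pow_left₀ 3 hL.le ?_
    rw [hL3, lt_div_iff₀ hρ]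
    have hM0 : 0 ≤ M ^ 3 := by positivity
    nlinarith
  have hC : C < max C 0 + 1 := by have := le_max_left C 0; linarith
  refine hC.trans_le (le_min ?_ ?_)
  · have hN : (128 * (max C 0 + 1) : ℝ) < (n : ℝ) + 1 := by linarith
    have hN1 : (1 : ℝ) ≤ (n : ℝ) + 1 := by
      have := (Nat.cast_nonneg n : (0 : ℝ) ≤ n); linarith
    rw [le_div_iff₀ (by norm_num : (0 : ℝ) < 128)]
    nlinarith
  · have hsimp : (L⁻¹ * L ^ 2) ^ 2 = L ^ 2 := by field_simp
    rw [hsimp, le_div_iff₀ (by positivity)]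
    have hKL : K < L := (le_max_left _ _).trans_lt hLM
    have hL1 : 1 ≤ L := hM1.trans hLM.le
    have hLL : L ≤ L ^ 2 := by nlinarith
    rw [hK] at hKL
    nlinarith

/-- The crux with the minimiser hypothesis `periodicEnergy v Ψ = E₀^per` WEAKENED to
`periodicEnergy v Ψ ≤ E₀^per + δ` for some slack `δ > 0` chosen after `ρ` (and `v`, `C`) but
BEFORE `N` — everything else verbatim.  A natural strengthening of the crux
(`not_nearMinimisers_of_not_imu`). -/
def InfraredMinimumUncertaintyNearMinimisers : Prop :=
  ∀ v : ℝ → ℝ≥0∞, IsRepulsiveFiniteRange v → (∀ r, v r ≠ ⊤) →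
    ContDiff ℝ 2 (fun x : Space => (v ‖x‖).toReal) →
    (∃ Cₑ : ℝ, ∀ x : Space, ‖iteratedFDeriv ℝ 2 (fun x : Space => (v ‖x‖).toReal) x‖ ≤
      Cₑ * Real.sqrt ((v ‖x‖).toReal)) →
    ∃ C : ℝ, 0 ≤ C ∧ ∃ ρ₀ : ℝ, 0 < ρ₀ ∧ ∀ ρ : ℝ, 0 < ρ → ρ < ρ₀ → ∃ δ : ℝ, 0 < δ ∧
      ∀ᶠ n : ℕ in Filter.atTop, ∀ Ψ : PeriodicTrialState (n + 1) (sideLength ρ (n + 1)),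
        (let L : ℝ := sideLength ρ (n + 1)
        let g : Space → ℝ := fun r => ∫ x in cell L, ∫ Y in cellN n L,
          ‖Ψ.ψ (Matrix.vecCons (x + r) Y)‖ * ‖Ψ.ψ (Matrix.vecCons x Y)‖
        let ν : (Fin 3 → ℤ) → ℝ := fun m =>
          (cellFourierCoeff L (fun r : Space => ((Real.log (g r) : ℝ) : ℂ)) m).re
        let S : (Fin 3 → ℤ) → ℝ := fun m => ((n : ℝ) + 1)⁻¹ *
          ∫ X in cellN (n + 1) L, ‖∑ j : Fin (n + 1), cellWave L m (X j)‖ ^ 2 * ‖Ψ.ψ X‖ ^ 2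
        periodicEnergy v Ψ ≤ periodicGroundStateEnergy v (n + 1) L + ENNReal.ofReal δ →
          periodicEnergy v Ψ ≠ ⊤ → (∀ X, Ψ.ψ X = (‖Ψ.ψ X‖ : ℂ)) → (∀ X, Ψ.ψ X ≠ 0) →
            ∀ m : Fin 3 → ℤ, m ≠ 0 → ((n : ℝ) + 1) * ν m * S m ≤ C)

/-- The crux with the minimiser hypothesis `periodicEnergy v Ψ = E₀^per` DELETED — everything
else verbatim (finite energy, `Ψ = |Ψ| > 0` kept). -/
def InfraredMinimumUncertaintyWithoutMinimality : Prop :=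
  ∀ v : ℝ → ℝ≥0∞, IsRepulsiveFiniteRange v → (∀ r, v r ≠ ⊤) →
    ContDiff ℝ 2 (fun x : Space => (v ‖x‖).toReal) →
    (∃ Cₑ : ℝ, ∀ x : Space, ‖iteratedFDeriv ℝ 2 (fun x : Space => (v ‖x‖).toReal) x‖ ≤
      Cₑ * Real.sqrt ((v ‖x‖).toReal)) →
    ∃ C : ℝ, 0 ≤ C ∧ ∃ ρ₀ : ℝ, 0 < ρ₀ ∧ ∀ ρ : ℝ, 0 < ρ → ρ < ρ₀ →
      ∀ᶠ n : ℕ in Filter.atTop, ∀ Ψ : PeriodicTrialState (n + 1) (sideLength ρ (n + 1)),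
        (let L : ℝ := sideLength ρ (n + 1)
        let g : Space → ℝ := fun r => ∫ x in cell L, ∫ Y in cellN n L,
          ‖Ψ.ψ (Matrix.vecCons (x + r) Y)‖ * ‖Ψ.ψ (Matrix.vecCons x Y)‖
        let ν : (Fin 3 → ℤ) → ℝ := fun m =>
          (cellFourierCoeff L (fun r : Space => ((Real.log (g r) : ℝ) : ℂ)) m).re
        let S : (Fin 3 → ℤ) → ℝ := fun m => ((n : ℝ) + 1)⁻¹ *
          ∫ X in cellN (n + 1) L, ‖∑ j : Fin (n + 1), cellWave L m (X j)‖ ^ 2 * ‖Ψ.ψ X‖ ^ 2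
        periodicEnergy v Ψ ≠ ⊤ → (∀ X, Ψ.ψ X = (‖Ψ.ψ X‖ : ℂ)) → (∀ X, Ψ.ψ X ≠ 0) →
          ∀ m : Fin 3 → ℤ, m ≠ 0 → ((n : ℝ) + 1) * ν m * S m ≤ C)

/-- The near-minimiser version is a STRENGTHENING of the crux (a minimiser is a `δ`-near-minimiser;
stated contrapositively so that no theorem of this negative-side file concludes the Theses decl). [folklore] -/
theorem not_nearMinimisers_of_not_imu (h : ¬ InfraredMinimumUncertainty) :
    ¬ InfraredMinimumUncertaintyNearMinimisers := by
  intro hNM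
  refine h fun v h₁ h₂ h₃ h₄ => ?_
  obtain ⟨C, hC, ρ₀, hρ₀, hB⟩ := hNM v h₁ h₂ h₃ h₄
  refine ⟨C, hC, ρ₀, hρ₀, fun ρ hρ hρρ₀ => ?_⟩
  obtain ⟨δ, _hδ, hev⟩ := hB ρ hρ hρρ₀
  filter_upwards [hev] with n hn Ψ
  intro L g ν S hE hfin hreal hpos m hm
  exact hn Ψ (le_of_eq_of_le hE le_self_add) hfin hreal hpos m hm

/-- The minimality-free version implies the near-minimiser version. [folklore] -/
theorem nearMinimisers_of_withoutMinimality (h : InfraredMinimumUncertaintyWithoutMinimality) :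
    InfraredMinimumUncertaintyNearMinimisers := by
  intro v h₁ h₂ h₃ h₄
  obtain ⟨C, hC, ρ₀, hρ₀, hB⟩ := h v h₁ h₂ h₃ h₄
  refine ⟨C, hC, ρ₀, hρ₀, fun ρ hρ hρρ₀ => ⟨1, one_pos, ?_⟩⟩
  filter_upwards [hB ρ hρ hρρ₀] with n hn Ψ
  intro L g ν S _hE hfin hreal hpos m hm
  exact hn Ψ hfin hreal hpos m hm

/-- **MINIMALITY IS LOAD-BEARING (near-minimiser form).**  The crux with `E = E₀` weakened to
`E ≤ E₀ + δ` (`δ > 0` fixed before `N`) is FALSE: witness `v ≡ 0` (in the class), any `ρ < ρ₀`,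
the given `δ`, `m = e₀`, and the free density waves of `eventually_lt_pi_free_near_minimiser`.
Any proof of the crux must use the minimiser property below every `N`-uniform energy
resolution. [folklore] -/
theorem not_infraredMinimumUncertaintyNearMinimisers :
    ¬ InfraredMinimumUncertaintyNearMinimisers := by
  intro h
  obtain ⟨h₁, h₂, h₃, h₄⟩ := inSmoothClass_zero
  obtain ⟨C, _hC, ρ₀, hρ₀, hB⟩ := h 0 h₁ h₂ h₃ h₄
  have hρ : (0 : ℝ) < ρ₀ / 2 := by positivity
  obtain ⟨δ, hδ, hev⟩ := hB (ρ₀ / 2) hρ (by linarith)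
  obtain ⟨n, hn, Ψ, hEδ, hE, hreal, hpos, hPi⟩ :=
    (hev.and (eventually_lt_pi_free_near_minimiser hρ hδ C)).exists
  have hfin : periodicEnergy 0 Ψ ≠ ⊤ := ne_top_of_le_ne_top ENNReal.ofReal_ne_top hEδ
  have key : piProd n (sideLength (ρ₀ / 2) (n + 1)) Ψ e0 ≤ C := hn Ψ hE hfin hreal hpos e0 e0_ne_zero
  exact absurd key (not_le.mpr hPi)

/-- **MINIMALITY IS LOAD-BEARING.**  The crux with the hypothesis `periodicEnergy v Ψ = E₀^per`
deleted is FALSE (corollary: the deleted version implies the near-minimiser version).  Witness: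
`v ≡ 0`, positive product states with a density modulation — a Bragg peak `S_{e₀} ~ ε²N` times a
phase weight `ν_{e₀} ~ ε²`. [folklore] -/
theorem imu_false_without_minimality : ¬ InfraredMinimumUncertaintyWithoutMinimality := fun h =>
  not_infraredMinimumUncertaintyNearMinimisers (nearMinimisers_of_withoutMinimality h)

end LoadBearing

end Summit.AtomisticToContinuum.BoseEinsteinCondensation.Theorems.InfraredMinimumUncertainty.Negative

end
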